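import Mathlib
import HarnessLib
import Literature.Probability.MarkovChains.DistinguishingStatistic

/-!
# Distinguishing statistics with the sharp constant: `|E_μ f − E_ν f| ≥ rσ ⇒ ‖μ − ν‖_TV ≥ 1 − 4/(4 + r²)` (Levin–Peres–Wilmer, Proposition 7.12)

HONEST FRAMING: exact (Metropolis-corrected) sampling algorithms for lattice gauge theory; figures
of merit are autocorrelation/cost numbers at stated couplings and volumes; no continuum-physics claim.

Finite state space `X`, laws as vectors `X → ℝ`, `tvDist` of `TotalVariation.lean`, `lawMean` /
`lawVariance` (`E_μ f`, `Var_μ f`) of `DistinguishingStatistic.lean` (which types Prop. 7.9, the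
constant `1 − 8/r²`, and lists Prop. 7.12 as "not here").  Source: D. A. Levin, Y. Peres (with
E. L. Wilmer), *Markov Chains and Mixing Times*, 2nd ed., AMS 2017 [LevinPeres2017], §7.3.
Everything is PROVED (finite sums; 0 named facts).

* `lawMean_sub_const`, `lawVariance_sub_const` (translation: "total variation distance is
  translation invariant … By translating, we can assume that `m_α = M` and `m_β = −M`"),
  `sum_mul_sq_eq_lawVariance_add_sq` (`E_μ f² = Var_μ(f) + (E_μ f)²`, eq. (7.15))
  [cite: LevinPeres2017, §7.3, proof of Prop. 7.12 (translation step; eq. (7.15))];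
* `sq_sub_lawMean_le_mul_tvDist` — the division-free heart of the proof, eqs. (7.14)–(7.16):
  **`(E_μ f − E_ν f)² ≤ [2(Var_μ f + Var_ν f) + (E_μ f − E_ν f)²]·‖μ − ν‖_TV`**, i.e. with
  `M = (E_μ f − E_ν f)/2`, `σ² = (Var_μ f + Var_ν f)/2`: `M² ≤ (M² + σ²)‖μ − ν‖_TV` ("Putting together
  (7.14), (7.15), and (7.16)"), valid for all probability vectors `μ, ν` with no non-degeneracy
  assumption [cite: LevinPeres2017, §7.3 Prop. 7.12 (proof, eqs. (7.14)–(7.16))];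
* **PROPOSITION 7.12** `LevinPeres2017_prop_7_12`: for probability vectors `μ, ν` on a finite `X`,
  `f : X → ℝ`, `σ² = [Var_μ(f) + Var_ν(f)]/2`: if `|E_μ(f) − E_ν(f)| ≥ rσ` (7.12) with `r ≥ 0` and
  `σ > 0`, then **`‖μ − ν‖_TV ≥ 1 − 4/(4 + r²)`** (7.13) [cite: LevinPeres2017, §7.3 Prop. 7.12
  eq. (7.12)–(7.13)]; Markov-chain form `LevinPeres2017_prop_7_12_chain` for `μ = Pᵗ(x,·)`, `ν = π`
  (the form used in Wilson's method, Theorem 13.28 eq. (13.34)).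
  SCOPE NOTE made explicit as hypotheses: `r ≥ 0` and `σ > 0` (as for Prop. 7.9 in
  `DistinguishingStatistic.lean`: with `σ = 0 = E_μ f − E_ν f`, e.g. `μ = ν`, hypothesis (7.12) holds
  for every `r` while (7.13) fails for `r > 0`; the printed proof uses `4M² ≥ r²σ²`, which is what
  (7.12) gives for `r ≥ 0`).

Proof = the printed one carried out on `X` itself instead of on the push-forwards `μf⁻¹, νf⁻¹` on
`Λ = f(X) ⊂ ℝ` (so Lemma 7.10 is not needed): translate `f` by `c = (E_μ f + E_ν f)/2`, write
`2M = Σ_x g(x)[μ(x) − ν(x)]`, apply Cauchy–Schwarz in the square-root-free form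
`(Σ r_x)² ≤ (Σ a_x)(Σ b_x)` for `r_x² ≤ a_x b_x` (Mathlib `Finset.sum_sq_le_sum_mul_sum_of_sq_le_mul`)
with `r_x = g(x)(μ−ν)(x)`, `a_x = g(x)²(μ+ν)(x)`, `b_x = |μ−ν|(x)` — this is (7.14) with `η = (μ+ν)/2`
combined with (7.16) `Σ (r−s)²η ≤ 4‖μ−ν‖_TV` (`|μ − ν| ≤ μ + ν`) — and (7.15).

Context (cell pub-lqcd, venture LatticeQCDFlow): the sharp-constant distinguishing-statistic bound is
the input of Wilson's lower-bound method (LPW Theorem 13.28); companion of Prop. 7.9.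
-/

namespace Literature.Probability.MarkovChains

open Finset

variable {X : Type*} [Fintype X]

/-! ## Translation and the second moment -/

/-- `E_μ(f − c) = E_μ(f) − c` for a probability vector `μ`. [cite: LevinPeres2017, §7.3, proof of
Prop. 7.12 ("By translating, we can assume that `m_α = M` and `m_β = −M`")] -/
theorem lawMean_sub_const {μ : X → ℝ} (hμ1 : ∑ x, μ x = 1) (f : X → ℝ) (c : ℝ) :
    lawMean μ (fun x => f x - c) = lawMean μ f - c := by
  unfold lawMean
  simp_rw [mul_sub, sum_sub_distrib, ← sum_mul, hμ1, one_mul]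

/-- `Var_μ(f − c) = Var_μ(f)` for a probability vector `μ` (the variance is translation invariant).
[cite: LevinPeres2017, §7.3, proof of Prop. 7.12 ("Total variation distance is translation
invariant"; the variances `Var(α)`, `Var(β)` in (7.15) are those of the translated laws)] -/
theorem lawVariance_sub_const {μ : X → ℝ} (hμ1 : ∑ x, μ x = 1) (f : X → ℝ) (c : ℝ) :
    lawVariance μ (fun x => f x - c) = lawVariance μ f := by
  unfold lawVariance
  rw [lawMean_sub_const hμ1]
  exact sum_congr rfl fun x _ => by ring

/-- The second moment: `E_μ(f²) = Var_μ(f) + (E_μ f)²` for a probability vector `μ` — eq. (7.15)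
`Σ x² η(x) = (m_α² + Var(α) + m_β² + Var(β))/2` termwise. [cite: LevinPeres2017, §7.3, proof of
Prop. 7.12, eq. (7.15)] -/
theorem sum_mul_sq_eq_lawVariance_add_sq {μ : X → ℝ} (hμ1 : ∑ x, μ x = 1) (f : X → ℝ) :
    ∑ x, μ x * f x ^ 2 = lawVariance μ f + lawMean μ f ^ 2 := by
  unfold lawVariance
  set m := lawMean μ f with hm
  have h : ∀ x, μ x * (f x - m) ^ 2 = μ x * f x ^ 2 - 2 * m * (μ x * f x) + m ^ 2 * μ x := by
    intro x; ring
  simp_rw [h, sum_add_distrib, sum_sub_distrib, ← mul_sum, hμ1]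
  unfold lawMean at hm
  rw [← hm]
  ring

/-! ## Proposition 7.12 -/

/-- The heart of Prop. 7.12, division-free: for probability vectors `μ, ν` and any `f`,
**`(E_μ f − E_ν f)² ≤ [2(Var_μ f + Var_ν f) + (E_μ f − E_ν f)²]·‖μ − ν‖_TV`** — with
`M = (E_μ f − E_ν f)/2`, `σ² = (Var_μ f + Var_ν f)/2` this is `M² ≤ (M² + σ²)‖μ − ν‖_TV`, i.e.
"`‖α − β‖_TV ≥ 1 − σ²/(σ² + M²)`".  Proof: (7.14) Cauchy–Schwarz for `2M = Σ g(μ − ν)` with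
`g = f − (E_μ f + E_ν f)/2`, (7.15), and (7.16) `|μ − ν| ≤ μ + ν`.
[cite: LevinPeres2017, §7.3 Prop. 7.12 (proof, eqs. (7.14)–(7.16))] -/
theorem sq_sub_lawMean_le_mul_tvDist {μ ν : X → ℝ} (hμ : ∀ x, 0 ≤ μ x) (hμ1 : ∑ x, μ x = 1)
    (hν : ∀ x, 0 ≤ ν x) (hν1 : ∑ x, ν x = 1) (f : X → ℝ) :
    (lawMean μ f - lawMean ν f) ^ 2 ≤
      (2 * (lawVariance μ f + lawVariance ν f) + (lawMean μ f - lawMean ν f) ^ 2) * tvDist μ ν := by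
  -- translate: `g = f − c`, `c = (m_μ + m_ν)/2`, so that `E_μ g = M`, `E_ν g = −M`
  set M : ℝ := (lawMean μ f - lawMean ν f) / 2 with hM
  set c : ℝ := (lawMean μ f + lawMean ν f) / 2 with hc
  set g : X → ℝ := fun x => f x - c with hg
  have hgμ : lawMean μ g = M := by rw [hg, lawMean_sub_const hμ1, hM, hc]; ring
  have hgν : lawMean ν g = -M := by rw [hg, lawMean_sub_const hν1, hM, hc]; ring
  have hVμ : lawVariance μ g = lawVariance μ f := lawVariance_sub_const hμ1 f c
  have hVν : lawVariance ν g = lawVariance ν f := lawVariance_sub_const hν1 f c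
  -- `2M = Σ_x g(x)[μ(x) − ν(x)]`
  have h2M : ∑ x, g x * (μ x - ν x) = 2 * M := by
    have : ∑ x, g x * (μ x - ν x) = lawMean μ g - lawMean ν g := by
      unfold lawMean
      rw [← sum_sub_distrib]
      exact sum_congr rfl fun x _ => by ring
    rw [this, hgμ, hgν]; ring
  -- (7.15): `Σ g²(μ + ν) = Var_μ + M² + Var_ν + M²`
  have h715 : ∑ x, g x ^ 2 * (μ x + ν x) = lawVariance μ f + lawVariance ν f + 2 * M ^ 2 := by
    have hsplit : ∑ x, g x ^ 2 * (μ x + ν x) = ∑ x, μ x * g x ^ 2 + ∑ x, ν x * g x ^ 2 := by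
      rw [← sum_add_distrib]; exact sum_congr rfl fun x _ => by ring
    rw [hsplit, sum_mul_sq_eq_lawVariance_add_sq hμ1, sum_mul_sq_eq_lawVariance_add_sq hν1,
      hgμ, hgν, hVμ, hVν]
    ring
  -- (7.16): `Σ |μ − ν| = 2‖μ − ν‖_TV`
  have h716 : ∑ x, |μ x - ν x| = 2 * tvDist μ ν := by unfold tvDist; ring
  -- (7.14): Cauchy–Schwarz, square-root free: `(Σ g(μ−ν))² ≤ (Σ g²(μ+ν))·(Σ |μ−ν|)`
  have h714 : (∑ x, g x * (μ x - ν x)) ^ 2 ≤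
      (∑ x, g x ^ 2 * (μ x + ν x)) * ∑ x, |μ x - ν x| := by
    refine Finset.sum_sq_le_sum_mul_sum_of_sq_le_mul univ
      (fun x _ => mul_nonneg (sq_nonneg _) (add_nonneg (hμ x) (hν x)))
      (fun x _ => abs_nonneg _) fun x _ => ?_
    -- `g²(μ−ν)² ≤ g²(μ+ν)|μ−ν|` since `|μ − ν| ≤ μ + ν`
    have hle : |μ x - ν x| ≤ μ x + ν x := by
      rw [abs_le]; constructor <;> linarith [hμ x, hν x]
    calc (g x * (μ x - ν x)) ^ 2 = g x ^ 2 * (|μ x - ν x| * |μ x - ν x|) := by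
          rw [mul_pow, ← sq, sq_abs]
      _ ≤ g x ^ 2 * ((μ x + ν x) * |μ x - ν x|) :=
          mul_le_mul_of_nonneg_left (mul_le_mul_of_nonneg_right hle (abs_nonneg _)) (sq_nonneg _)
      _ = g x ^ 2 * (μ x + ν x) * |μ x - ν x| := by ring
  rw [h2M, h715, h716] at h714
  -- `4M² ≤ (V + 2M²)·2·TV`, and `(m_μ − m_ν)² = 4M²`
  have hΔ : lawMean μ f - lawMean ν f = 2 * M := by rw [hM]; ring
  rw [hΔ]
  nlinarith [h714]

/-- **Proposition 7.12.**  Let `μ` and `ν` be two probability distributions on a finite `X`, and let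
`f` be a real-valued function on `X`.  If **`|E_μ(f) − E_ν(f)| ≥ rσ`** (7.12), where
`σ² = [Var_μ(f) + Var_ν(f)]/2`, with `r ≥ 0` and `σ > 0`, then **`‖μ − ν‖_TV ≥ 1 − 4/(4 + r²)`**
(7.13).  (`r ≥ 0`, `σ > 0`: the printed statement's implicit non-degeneracy, see the module
docstring.) [cite: LevinPeres2017, §7.3 Prop. 7.12 eq. (7.12)–(7.13)] -/
theorem LevinPeres2017_prop_7_12 {μ ν : X → ℝ} (hμ : ∀ x, 0 ≤ μ x) (hμ1 : ∑ x, μ x = 1)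
    (hν : ∀ x, 0 ≤ ν x) (hν1 : ∑ x, ν x = 1) (f : X → ℝ) {r : ℝ} (hr : 0 ≤ r)
    (hσ : 0 < (lawVariance μ f + lawVariance ν f) / 2)
    (h : r * Real.sqrt ((lawVariance μ f + lawVariance ν f) / 2) ≤ |lawMean μ f - lawMean ν f|) :
    1 - 4 / (4 + r ^ 2) ≤ tvDist μ ν := by
  set σ2 : ℝ := (lawVariance μ f + lawVariance ν f) / 2 with hσ2
  set Δ : ℝ := lawMean μ f - lawMean ν f with hΔ
  set T : ℝ := tvDist μ ν with hT
  -- (7.12) squared: `r²σ² ≤ Δ² = 4M²`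
  have h712 : r ^ 2 * σ2 ≤ Δ ^ 2 := by
    have h0 : 0 ≤ r * Real.sqrt σ2 := mul_nonneg hr (Real.sqrt_nonneg _)
    have h1 : (r * Real.sqrt σ2) ^ 2 ≤ |Δ| ^ 2 := pow_le_pow_left₀ h0 h 2
    rwa [mul_pow, Real.sq_sqrt hσ.le, sq_abs] at h1
  -- the heart: `Δ² ≤ (4σ² + Δ²)·T`
  have key : Δ ^ 2 ≤ (4 * σ2 + Δ ^ 2) * T := by
    have := sq_sub_lawMean_le_mul_tvDist hμ hμ1 hν hν1 f
    rw [← hΔ, ← hT] at this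
    calc Δ ^ 2 ≤ (2 * (lawVariance μ f + lawVariance ν f) + Δ ^ 2) * T := this
      _ = (4 * σ2 + Δ ^ 2) * T := by rw [hσ2]; ring
  have hT0 : 0 ≤ T := tvDist_nonneg μ ν
  have h4r : 0 < 4 + r ^ 2 := by positivity
  -- `1 − 4/(4 + r²) = r²/(4 + r²) ≤ T` ⇔ `r²(1 − T) ≤ 4T`
  have goal : r ^ 2 * (1 - T) ≤ 4 * T := by
    rcases le_or_gt T 1 with hT1 | hT1
    · -- `r²σ²(1 − T) ≤ Δ²(1 − T) ≤ 4σ²T`, then divide by `σ² > 0`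
      have h1 : r ^ 2 * σ2 * (1 - T) ≤ Δ ^ 2 * (1 - T) :=
        mul_le_mul_of_nonneg_right h712 (by linarith)
      have h2 : Δ ^ 2 * (1 - T) ≤ 4 * σ2 * T := by nlinarith [key]
      have h3 : σ2 * (r ^ 2 * (1 - T)) ≤ σ2 * (4 * T) := by nlinarith [h1, h2]
      exact le_of_mul_le_mul_left h3 hσ
    · have : r ^ 2 * (1 - T) ≤ 0 := mul_nonpos_of_nonneg_of_nonpos (sq_nonneg r) (by linarith)
      linarith
  have : 1 - 4 / (4 + r ^ 2) = r ^ 2 / (4 + r ^ 2) := by field_simp; ring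
  rw [this, div_le_iff₀ h4r]
  linarith

/-- **Proposition 7.12, Markov-chain form**: for a row-stochastic `P`, a probability vector `π`, a
state `x`, a time `t` and a statistic `f`: if `|E_x[f(X_t)] − E_π(f)| ≥ rσ` with
`σ² = [Var_{Pᵗ(x,·)}(f) + Var_π(f)]/2 > 0`, `r ≥ 0`, then `‖Pᵗ(x,·) − π‖_TV ≥ 1 − 4/(4 + r²)` (the form
applied in the proof of Wilson's method, eq. (13.34)). [cite: LevinPeres2017, §7.3 Prop. 7.12 with
§13.5 eq. (13.34)] -/
theorem LevinPeres2017_prop_7_12_chain [DecidableEq X] {P : X → X → ℝ} (hP : IsRowStochastic P)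
    {π : X → ℝ} (hπ0 : ∀ x, 0 ≤ π x) (hπ1 : ∑ x, π x = 1) (x : X) (t : ℕ) (f : X → ℝ)
    {r : ℝ} (hr : 0 ≤ r)
    (hσ : 0 < (lawVariance (lawAt P (Pi.single x 1) t) f + lawVariance π f) / 2)
    (h : r * Real.sqrt ((lawVariance (lawAt P (Pi.single x 1) t) f + lawVariance π f) / 2) ≤
      |lawMean (lawAt P (Pi.single x 1) t) f - lawMean π f|) :
    1 - 4 / (4 + r ^ 2) ≤ tvDist (lawAt P (Pi.single x 1) t) π := by
  have h0 : ∀ z, 0 ≤ (Pi.single x (1 : ℝ) : X → ℝ) z := fun z => by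
    rw [Pi.single_apply]; split_ifs <;> norm_num
  have h1 : ∑ z, lawAt P (Pi.single x 1) t z = 1 := by
    rw [sum_lawAt hP, Finset.sum_pi_single']; simp
  exact LevinPeres2017_prop_7_12 (fun z => lawAt_nonneg hP h0 t z) h1 hπ0 hπ1 f hr hσ h

end Literature.Probability.MarkovChains
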